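import Literature.Probability.LatticeModels.SlitPlaneSourceMatching
import Literature.Probability.LatticeModels.IsingDisorderSeam
import Literature.Probability.LatticeModels.DiscreteCauchyRiemann
import HarnessLib

/-!
# Matching the branch cuts: the gauged full-plane spinor and the spin fermion have the same seam

Topic `Literature/Probability/LatticeModels`. Chelkak–Hongler–Izyurov (Ann. of Math. 181 (2015)),
Lemma 3.5 / Remark 3.9: `F^{(a)} := F_{[Ω_δ,a]} - F_{[ℂ_δ,a]}` is an s-holomorphic SPINOR near `a`
(on the double cover), so `H^{(a)} = Re ∫ (F^{(a)})²` is single valued and sub- and super-harmonic near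
`a`. In the tree both spinors are realised by sections: the signed Kadanoff–Ceva observable `kcObs`
(`IsingDisorderObservable.lean`), whose cut is the seam of lower corners on the east half-row from
the source corner (`IsingDisorderSeam.lean`: opposite projections there), and the explicit spinor
`slitFC p₀` (`SlitPlaneSpinorCorners.lean`), whose cut is the diagonal `srcDY = 0` (CHI's `L_a`).
Here the explicit spinor is re-gauged by the bond sign `slitChi p₀` (`-1` on the bonds strictly
between the two cuts, `+1` elsewhere) so that the two sections have the SAME seam, and the table of
the difference

  `D := kcObs - S₀ · slitChi · slitFC p₀`,  `S₀ = ⟨σ_{v₀}⟩`,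

is established corner by corner near the source plaquette `p₀` (offsets `(I, J)` of the corner's
site from `v₀ = p₀ + e₀ + e₁`):

* gauge lemmas (`isSHolAt_sign_mul_iff`, `anti_sign_mul_iff`, linearity `isSHolAt_sub_smul`,
  `anti_sub_smul`);
* the table of `slitChi · slitFC` (`isSHolAt_slitFCg_zero/one`, `_two` off the seam, `_three` off the
  seam, `anti_slitFCg_two/three` on the seam): its only failures are OPPOSITE projections at the seam
  corners `(v₀ + (I,0), SW)`, `I ≥ 1`, and `(v₀ + (I,0), SE)`, `I ≥ 0` — exactly `kcObs`'s seam —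
  (the sign jumps at the `NE` corners of the diagonal are invisible because both sheets vanish on the
  slit, `slitFC_zero_on_slit`);
* **the table of `D`** (`isSHolAt_kcObs_sub_zero/one/two/three`, `anti_kcObs_sub_two/three`,
  `isSHolAt_kcObs_sub_source`): under the hypotheses of `isSHolAt_kcObs_*` (admissible cut steps)
  `D` is s-holomorphic at every corner off the seam, INCLUDING the source corner (Lemma 3.5,
  `SlitPlaneSourceMatching.lean`), and has opposite projections on the seam — i.e. `D` is an honest
  s-holomorphic spinor near `a` with the branching of a spinor, which is what Remark 3.9 consumes
  (`cornerFlux` increments of `H` are sign-blind).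

Everything is proved; no named fact.

## References

* D. Chelkak, C. Hongler, K. Izyurov, Ann. of Math. 181 (2015) = arXiv:1202.2838: Lemma 3.5,
  Remark 3.9, §3.2 [ChelkakHonglerIzyurovAnnals2015].
-/

noncomputable section

namespace Literature.Probability.LatticeModels

open Complex ComplexConjugate SimpleGraph

/-! ### Gauge lemmas: bond signs and projections -/

/-- Projection is real-linear in the projected vector: `Proj[t X ; η] = t Proj[X ; η]`. [folklore] -/
theorem projLine_ofReal_mul_right (t : ℝ) (η X : ℂ) : projLine η ((t : ℂ) * X) = (t : ℂ) * projLine η X := by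
  rw [projLine_eq, projLine_eq, Complex.real_smul, Complex.real_smul, ← mul_assoc]
  congr 1
  rw [mul_assoc, Complex.re_ofReal_mul]
  push_cast
  ring

/-- **Opposite projections** of a bond function `F` at the coded corner `q` (the relation across a
branch cut of a spinor section). [folklore] -/
def IsAntiAt (F : MedialVertex → ℂ) (q : Site 2 × Fin 4) : Prop :=
  projLine (cornerLine q.1 (cFace q)) (F (cSrc q)) = -projLine (cornerLine q.1 (cFace q)) (F (cTgt q))

/-- **Gauge lemma, equal signs**: multiplying a bond function by a bond sign that agrees on the two
bonds of a corner does not change `IsSHolAt` there. [folklore] -/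
theorem isSHolAt_sign_mul_iff {χ : MedialVertex → ℝ} {F : MedialVertex → ℂ} {q : Site 2 × Fin 4}
    (hχ : χ (cSrc q) = 1 ∨ χ (cSrc q) = -1) (heq : χ (cTgt q) = χ (cSrc q)) :
    IsSHolAt (fun e => (χ e : ℂ) * F e) q ↔ IsSHolAt F q := by
  unfold IsSHolAt
  simp only [heq, projLine_ofReal_mul_right]
  constructor
  · intro h
    rcases hχ with h1 | h1 <;> rw [h1] at h <;> simpa using h
  · intro h; rw [h]

/-- **Gauge lemma, opposite signs**: if the bond sign differs on the two bonds of a corner then the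
signed function is `IsSHolAt` there iff the original one has opposite projections, and vice versa. [folklore] -/
theorem isSHolAt_sign_mul_iff_anti {χ : MedialVertex → ℝ} {F : MedialVertex → ℂ} {q : Site 2 × Fin 4}
    (hχ : χ (cSrc q) = 1 ∨ χ (cSrc q) = -1) (hop : χ (cTgt q) = -χ (cSrc q)) :
    (IsSHolAt (fun e => (χ e : ℂ) * F e) q ↔ IsAntiAt F q) ∧ (IsAntiAt (fun e => (χ e : ℂ) * F e) q ↔ IsSHolAt F q) := by
  have hs : (χ (cSrc q) : ℂ) ≠ 0 := by
    rcases hχ with h | h <;> rw [h] <;> norm_num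
  unfold IsSHolAt IsAntiAt
  simp only [hop, projLine_ofReal_mul_right]
  set P := projLine (cornerLine q.1 (cFace q)) (F (cSrc q))
  set Q := projLine (cornerLine q.1 (cFace q)) (F (cTgt q))
  push_cast
  constructor
  · constructor
    · intro h; exact mul_left_cancel₀ hs (h.trans (by ring))
    · intro h; rw [h]; ring
  · constructor
    · intro h; exact mul_left_cancel₀ hs (h.trans (by ring))
    · intro h; rw [h]; ring

/-- Linearity: `IsSHolAt` is preserved by `F - c • G`. [folklore] -/
theorem isSHolAt_sub_smul {F G : MedialVertex → ℂ} {q : Site 2 × Fin 4} (c : ℝ) (hF : IsSHolAt F q) (hG : IsSHolAt G q) :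
    IsSHolAt (fun e => F e - (c : ℂ) * G e) q := by
  unfold IsSHolAt at *
  simp only [projLine_sub, projLine_ofReal_mul_right, hF, hG]

/-- Linearity: opposite projections are preserved by `F - c • G`. [folklore] -/
theorem anti_sub_smul {F G : MedialVertex → ℂ} {q : Site 2 × Fin 4} (c : ℝ) (hF : IsAntiAt F q) (hG : IsAntiAt G q) :
    IsAntiAt (fun e => F e - (c : ℂ) * G e) q := by
  unfold IsAntiAt at *
  simp only [projLine_sub, projLine_ofReal_mul_right, hF, hG]
  ring


/-- `IsSHolAt` only depends on the two bond values at the corner. [folklore] -/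
theorem isSHolAt_congr {F G : MedialVertex → ℂ} {q : Site 2 × Fin 4} (h1 : F (cSrc q) = G (cSrc q)) (h2 : F (cTgt q) = G (cTgt q)) :
    IsSHolAt F q ↔ IsSHolAt G q := by
  unfold IsSHolAt; rw [h1, h2]

/-- A vanishing frame coordinate means a vanishing projection onto the corner line. [folklore] -/
theorem projLine_cornerLine_eq_zero (y : Site 2) (k : Fin 4) {n : ℕ} (hn : n % 4 = (k : ℕ)) {X : ℂ}
    (h : (frameCoord 0 X * (1 + I) ^ n).re = 0) : projLine (cornerLine y (faceAt y k)) X = 0 := by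
  have h0 : projLine (cornerLine y (faceAt y k)) 0 = 0 := by simp [projLine]
  rw [← h0, projLine_cornerLine_eq_iff 0 y k hn, h]
  simp [frameCoord]

/-! ### The bond sign between the two cuts -/

/-- Offset abscissa of the site `y` from the source site `v₀ = p₀ + e₀ + e₁`. [folklore] -/
def srcI (p₀ y : Site 2) : ℤ := y 0 - p₀ 0 - 1

/-- Offset ordinate of the site `y` from `v₀`. [folklore] -/
def srcJ (p₀ y : Site 2) : ℤ := y 1 - p₀ 1 - 1

/-- The dictionary with `srcDX`, `srcDY`: `x = I + J + 2`, `y = J - I`. [folklore] -/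
theorem srcDX_eq (p₀ y : Site 2) : srcDX p₀ y = srcI p₀ y + srcJ p₀ y + 2 ∧ srcDY p₀ y = srcJ p₀ y - srcI p₀ y := by
  simp only [srcDX, srcDY, srcI, srcJ]; constructor <;> ring

/-- Offsets of the west and south neighbours. [folklore] -/
theorem srcI_west_south (p₀ y : Site 2) :
    srcI p₀ (y + cornerUnit 2) = srcI p₀ y - 1 ∧ srcJ p₀ (y + cornerUnit 2) = srcJ p₀ y ∧
    srcI p₀ (y + cornerUnit 3) = srcI p₀ y ∧ srcJ p₀ (y + cornerUnit 3) = srcJ p₀ y - 1 := by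
  refine ⟨?_, ?_, ?_, ?_⟩ <;> simp [srcI, srcJ, cornerUnit] <;> omega

/-- **The sign of an east bond** `{y, y + e₀}` (midpoint `(I + ½, J)`): `-1` iff `0 ≤ J ≤ I`, i.e.
strictly between the seam row and the diagonal cut. [folklore] -/
def slitChiH (p₀ y : Site 2) : ℝ := if 0 ≤ srcJ p₀ y ∧ srcJ p₀ y ≤ srcI p₀ y then -1 else 1

/-- **The sign of a north bond** `{x, x + e₁}` (midpoint `(I, J + ½)`): `-1` iff `0 ≤ J ≤ I - 1`. [folklore] -/
def slitChiV (p₀ x : Site 2) : ℝ := if 0 ≤ srcJ p₀ x ∧ srcJ p₀ x ≤ srcI p₀ x - 1 then -1 else 1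

open scoped Classical in
/-- **The bond sign `χ`** re-gauging the explicit spinor from its cut (the diagonal) to `kcObs`'s
seam (the east half-row): `slitChiH` on east bonds, `slitChiV` on north bonds, `1` on non-bonds. [folklore] -/
def slitChi (p₀ : Site 2) (e : MedialVertex) : ℝ :=
  if h : ∃ v : Site 2, e = s(v, v + cornerUnit 0) then slitChiH p₀ h.choose
  else if h' : ∃ x : Site 2, e = s(x, x + cornerUnit 1) then slitChiV p₀ h'.choose else 1

/-- The sign on an east bond. [folklore] -/
theorem slitChi_east (p₀ v : Site 2) : slitChi p₀ s(v, v + cornerUnit 0) = slitChiH p₀ v := by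
  classical
  have h : ∃ u : Site 2, s(v, v + cornerUnit 0) = s(u, u + cornerUnit 0) := ⟨v, rfl⟩
  rw [slitChi, dif_pos h, eastBond_injective h.choose_spec.symm]

/-- The sign on a north bond. [folklore] -/
theorem slitChi_north (p₀ x : Site 2) : slitChi p₀ s(x, x + cornerUnit 1) = slitChiV p₀ x := by
  classical
  have h : ¬ ∃ u : Site 2, s(x, x + cornerUnit 1) = s(u, u + cornerUnit 0) := fun ⟨u, hu⟩ => northBond_ne_eastBond x u hu
  have h' : ∃ u : Site 2, s(x, x + cornerUnit 1) = s(u, u + cornerUnit 1) := ⟨x, rfl⟩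
  rw [slitChi, dif_neg h, dif_pos h', northBond_injective h'.choose_spec.symm]

/-- The signs are `±1`. [folklore] -/
theorem slitChiH_cases (p₀ y : Site 2) : slitChiH p₀ y = 1 ∨ slitChiH p₀ y = -1 := by
  unfold slitChiH; split_ifs <;> simp

/-- The signs are `±1`. [folklore] -/
theorem slitChiV_cases (p₀ x : Site 2) : slitChiV p₀ x = 1 ∨ slitChiV p₀ x = -1 := by
  unfold slitChiV; split_ifs <;> simp

/-- **The gauged explicit spinor** `χ · F_C`. [cite: ChelkakHonglerIzyurovAnnals2015, §3.2 and Lemma 3.5] -/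
def slitFCg (p₀ : Site 2) (e : MedialVertex) : ℂ := (slitChi p₀ e : ℂ) * slitFC p₀ e

/-! ### The table of the gauged spinor -/

/-- **On the slit the explicit spinor vanishes at the `1`-type corners**: for a site on the diagonal
through `v₀` north-east of the tip (`srcJ = srcI ≥ 0`, i.e. `srcDY = 0`, `srcDX ≥ 2`) both bonds at
`(y, NE)` carry `a = 0`. [cite: ChelkakHonglerIzyurovAnnals2015, §3.2 (F_C = 0 on L_a)] -/
theorem frameCoord_slitFC_zero_on_slit (p₀ y : Site 2) (hJ : srcJ p₀ y = srcI p₀ y) (hI : 0 ≤ srcI p₀ y) :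
    (frameCoord 0 (slitFC p₀ (cSrc (y, 0))) * (1 + I) ^ 0).re = 0 ∧ (frameCoord 0 (slitFC p₀ (cTgt (y, 0))) * (1 + I) ^ 0).re = 0 := by
  have hDY : srcDY p₀ y = 0 := by rw [(srcDX_eq p₀ y).2]; omega
  have hk : -srcDX p₀ y = -(2 * srcI p₀ y + 2) := by rw [(srcDX_eq p₀ y).1]; omega
  have heven : Even (-srcDX p₀ y) := ⟨-(srcI p₀ y + 1), by rw [hk]; ring⟩
  have hle : -srcDX p₀ y ≤ -2 := by rw [hk]; omega
  have hup : slitFup (-srcDX p₀ y) 0 = 0 := slitFup_row_eq_zero (Or.inl ⟨heven, hle⟩)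
  have hdn : slitFdn (-srcDX p₀ y) 0 = 0 := by rw [← slitFup_eq_slitFdn (Or.inr (Or.inl heven)), hup]
  have hval : ∀ σ : ℤ, (slitFsh σ (-srcDX p₀ y) (srcDY p₀ y)).re = 0 := by
    intro σ; unfold slitFsh; rw [hDY]; split_ifs
    · rw [hup, Complex.zero_re]
    · rw [hdn, Complex.zero_re]
  simp only [cSrc, cTgt, show (0 : Fin 4) + 1 = 1 from rfl, slitFC_east, slitFC_north]
  rw [slitFCH, slitFCV, re_frameCoord_kcVec_zero, re_frameCoord_kcVec_zero, hval, hval]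
  simp

/-- **`χ F_C` at the `1`-type corners**: `IsSHolAt` at every `(y, NE)` (the only sign jumps there sit
on the slit, where the values vanish). [cite: ChelkakHonglerIzyurovAnnals2015, Lemma 2.14 and §3.2] -/
theorem isSHolAt_slitFCg_zero (p₀ y : Site 2) : IsSHolAt (slitFCg p₀) (y, 0) := by
  by_cases hj : srcJ p₀ y = srcI p₀ y ∧ 0 ≤ srcI p₀ y
  · -- on the slit: both projections vanish
    obtain ⟨h1, h2⟩ := frameCoord_slitFC_zero_on_slit p₀ y hj.1 hj.2
    have hn : (0 : ℕ) % 4 = ((0 : Fin 4) : ℕ) := by norm_num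
    unfold IsSHolAt slitFCg
    simp only [cFace]
    rw [projLine_ofReal_mul_right, projLine_ofReal_mul_right, projLine_cornerLine_eq_zero y 0 hn h1,
      projLine_cornerLine_eq_zero y 0 hn h2, mul_zero, mul_zero]
  · -- no jump
    have heq : slitChi p₀ (cTgt (y, 0)) = slitChi p₀ (cSrc (y, 0)) := by
      simp only [cSrc, cTgt, show (0 : Fin 4) + 1 = 1 from rfl, slitChi_east, slitChi_north, slitChiH, slitChiV]
      by_cases ha : 0 ≤ srcJ p₀ y ∧ srcJ p₀ y ≤ srcI p₀ y
      · rw [if_pos ha, if_pos (show 0 ≤ srcJ p₀ y ∧ srcJ p₀ y ≤ srcI p₀ y - 1 by omega)]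
      · rw [if_neg ha, if_neg (show ¬(0 ≤ srcJ p₀ y ∧ srcJ p₀ y ≤ srcI p₀ y - 1) by omega)]
    have hχ : slitChi p₀ (cSrc (y, 0)) = 1 ∨ slitChi p₀ (cSrc (y, 0)) = -1 := by
      simp only [cSrc, slitChi_east]; exact slitChiH_cases p₀ y
    exact (isSHolAt_sign_mul_iff (F := slitFC p₀) hχ heq).2 (isSHolAt_slitFC_zero p₀ y)

/-- **`χ F_C` at the `λ̄`-type corners**: `IsSHolAt` at every `(y, NW)` (no sign jump). [cite: ChelkakHonglerIzyurovAnnals2015, Lemma 2.14] -/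
theorem isSHolAt_slitFCg_one (p₀ y : Site 2) : IsSHolAt (slitFCg p₀) (y, 1) := by
  obtain ⟨hwI, hwJ, -, -⟩ := srcI_west_south p₀ y
  have heq : slitChi p₀ (cTgt (y, 1)) = slitChi p₀ (cSrc (y, 1)) := by
    simp only [cSrc, cTgt, show (1 : Fin 4) + 1 = 2 from rfl, westBond_eq, slitChi_east, slitChi_north, slitChiH, slitChiV,
      hwI, hwJ]
  have hχ : slitChi p₀ (cSrc (y, 1)) = 1 ∨ slitChi p₀ (cSrc (y, 1)) = -1 := by
    simp only [cSrc, slitChi_north]; exact slitChiV_cases p₀ y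
  exact (isSHolAt_sign_mul_iff (F := slitFC p₀) hχ heq).2 (isSHolAt_slitFC_one p₀ y)

/-- The explicit spinor's cut in `IsAntiAt` form: opposite projections at `(y, SW)` on the diagonal. [cite: ChelkakHonglerIzyurovAnnals2015, §3.2] -/
theorem isAntiAt_slitFC_two (p₀ y : Site 2) (hs : srcDY p₀ y = 0) : IsAntiAt (slitFC p₀) (y, 2) := by
  unfold IsAntiAt
  simp only [cFace]
  rw [projLine_cornerLine_eq_neg_iff 0 y 2 (n := 2) (by norm_num)]
  exact frameCoord_slitFC_two_cut p₀ y hs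

/-- The two signs at the corner `(y, SW)`: west bond `slitChiH (y - e₀)`, south bond `slitChiV (y - e₁)`. [folklore] -/
theorem slitChi_two (p₀ y : Site 2) :
    slitChi p₀ (cSrc (y, 2)) = (if 0 ≤ srcJ p₀ y ∧ srcJ p₀ y ≤ srcI p₀ y - 1 then -1 else 1) ∧
    slitChi p₀ (cTgt (y, 2)) = (if 1 ≤ srcJ p₀ y ∧ srcJ p₀ y ≤ srcI p₀ y then -1 else 1) := by
  obtain ⟨hwI, hwJ, hsI, hsJ⟩ := srcI_west_south p₀ y
  simp only [cSrc, cTgt, show (2 : Fin 4) + 1 = 3 from rfl, westBond_eq, southBond_eq, slitChi_east, slitChi_north, slitChiH,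
    slitChiV, hwI, hwJ, hsI, hsJ]
  constructor
  · first | rfl | trivial
  · by_cases h : 1 ≤ srcJ p₀ y ∧ srcJ p₀ y ≤ srcI p₀ y
    · rw [if_pos h, if_pos (show 0 ≤ srcJ p₀ y - 1 ∧ srcJ p₀ y - 1 ≤ srcI p₀ y - 1 by omega)]
    · rw [if_neg h, if_neg (show ¬(0 ≤ srcJ p₀ y - 1 ∧ srcJ p₀ y - 1 ≤ srcI p₀ y - 1) by omega)]

/-- The two signs at the corner `(y, SE)`: south bond `slitChiV (y - e₁)`, east bond `slitChiH y`. [folklore] -/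
theorem slitChi_three (p₀ y : Site 2) :
    slitChi p₀ (cSrc (y, 3)) = (if 1 ≤ srcJ p₀ y ∧ srcJ p₀ y ≤ srcI p₀ y then -1 else 1) ∧
    slitChi p₀ (cTgt (y, 3)) = (if 0 ≤ srcJ p₀ y ∧ srcJ p₀ y ≤ srcI p₀ y then -1 else 1) := by
  obtain ⟨-, -, hsI, hsJ⟩ := srcI_west_south p₀ y
  simp only [cSrc, cTgt, show (3 : Fin 4) + 1 = 0 from rfl, southBond_eq, slitChi_east, slitChi_north, slitChiH, slitChiV,
    hsI, hsJ]
  constructor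
  · by_cases h : 1 ≤ srcJ p₀ y ∧ srcJ p₀ y ≤ srcI p₀ y
    · rw [if_pos h, if_pos (show 0 ≤ srcJ p₀ y - 1 ∧ srcJ p₀ y - 1 ≤ srcI p₀ y - 1 by omega)]
    · rw [if_neg h, if_neg (show ¬(0 ≤ srcJ p₀ y - 1 ∧ srcJ p₀ y - 1 ≤ srcI p₀ y - 1) by omega)]
  · first | rfl | trivial

/-- **`χ F_C` at `(y, SW)` off the seam and off the source**: `IsSHolAt` (on the diagonal cut the sign
jump and the sheet change cancel). [cite: ChelkakHonglerIzyurovAnnals2015, Lemma 3.5 and §3.2] -/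
theorem isSHolAt_slitFCg_two (p₀ y : Site 2) (hseam : ¬(srcJ p₀ y = 0 ∧ 1 ≤ srcI p₀ y))
    (hsrc : ¬(srcI p₀ y = 0 ∧ srcJ p₀ y = 0)) : IsSHolAt (slitFCg p₀) (y, 2) := by
  obtain ⟨h1, h2⟩ := slitChi_two p₀ y
  have hχ : slitChi p₀ (cSrc (y, 2)) = 1 ∨ slitChi p₀ (cSrc (y, 2)) = -1 := by rw [h1]; split_ifs <;> simp
  by_cases hcut : srcI p₀ y = srcJ p₀ y ∧ 1 ≤ srcJ p₀ y
  · -- on the diagonal: opposite signs, anti values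
    have hop : slitChi p₀ (cTgt (y, 2)) = -slitChi p₀ (cSrc (y, 2)) := by
      rw [h1, h2, if_neg (show ¬(0 ≤ srcJ p₀ y ∧ srcJ p₀ y ≤ srcI p₀ y - 1) by omega),
        if_pos (show 1 ≤ srcJ p₀ y ∧ srcJ p₀ y ≤ srcI p₀ y by omega)]
    have hDY : srcDY p₀ y = 0 := by rw [(srcDX_eq p₀ y).2]; omega
    exact ((isSHolAt_sign_mul_iff_anti (F := slitFC p₀) hχ hop).1).2 (isAntiAt_slitFC_two p₀ y hDY)
  · -- generic: equal signs, honest values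
    have heq : slitChi p₀ (cTgt (y, 2)) = slitChi p₀ (cSrc (y, 2)) := by
      rw [h1, h2]
      by_cases ha : 0 ≤ srcJ p₀ y ∧ srcJ p₀ y ≤ srcI p₀ y - 1
      · rw [if_pos ha, if_pos (show 1 ≤ srcJ p₀ y ∧ srcJ p₀ y ≤ srcI p₀ y by omega)]
      · rw [if_neg ha, if_neg (show ¬(1 ≤ srcJ p₀ y ∧ srcJ p₀ y ≤ srcI p₀ y) by omega)]
    have hoff : srcDY p₀ y ≠ 0 ∨ srcDX p₀ y ≤ 0 := by
      rw [(srcDX_eq p₀ y).1, (srcDX_eq p₀ y).2]; omega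
    exact (isSHolAt_sign_mul_iff (F := slitFC p₀) hχ heq).2 (isSHolAt_slitFC_two p₀ y hoff)

/-- **`χ F_C` at a seam corner `(v₀ + (I, 0), SW)`, `I ≥ 1`: opposite projections** (the sign jumps,
the values are honest). [cite: ChelkakHonglerIzyurovAnnals2015, §3.2] -/
theorem isAntiAt_slitFCg_two (p₀ y : Site 2) (hJ : srcJ p₀ y = 0) (hI : 1 ≤ srcI p₀ y) : IsAntiAt (slitFCg p₀) (y, 2) := by
  obtain ⟨h1, h2⟩ := slitChi_two p₀ y
  have hχ : slitChi p₀ (cSrc (y, 2)) = 1 ∨ slitChi p₀ (cSrc (y, 2)) = -1 := by rw [h1]; split_ifs <;> simp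
  have hop : slitChi p₀ (cTgt (y, 2)) = -slitChi p₀ (cSrc (y, 2)) := by
    rw [h1, h2, if_pos (show 0 ≤ srcJ p₀ y ∧ srcJ p₀ y ≤ srcI p₀ y - 1 by omega),
      if_neg (show ¬(1 ≤ srcJ p₀ y ∧ srcJ p₀ y ≤ srcI p₀ y) by omega)]
    norm_num
  have hoff : srcDY p₀ y ≠ 0 ∨ srcDX p₀ y ≤ 0 := by rw [(srcDX_eq p₀ y).2]; omega
  exact ((isSHolAt_sign_mul_iff_anti (F := slitFC p₀) hχ hop).2).2 (isSHolAt_slitFC_two p₀ y hoff)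

/-- **`χ F_C` at `(y, SE)` off the seam**: `IsSHolAt`. [cite: ChelkakHonglerIzyurovAnnals2015, Lemma 2.14] -/
theorem isSHolAt_slitFCg_three (p₀ y : Site 2) (hseam : ¬(srcJ p₀ y = 0 ∧ 0 ≤ srcI p₀ y)) : IsSHolAt (slitFCg p₀) (y, 3) := by
  obtain ⟨h1, h2⟩ := slitChi_three p₀ y
  have hχ : slitChi p₀ (cSrc (y, 3)) = 1 ∨ slitChi p₀ (cSrc (y, 3)) = -1 := by rw [h1]; split_ifs <;> simp
  have heq : slitChi p₀ (cTgt (y, 3)) = slitChi p₀ (cSrc (y, 3)) := by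
    rw [h1, h2]
    by_cases ha : 1 ≤ srcJ p₀ y ∧ srcJ p₀ y ≤ srcI p₀ y
    · rw [if_pos ha, if_pos (show 0 ≤ srcJ p₀ y ∧ srcJ p₀ y ≤ srcI p₀ y by omega)]
    · rw [if_neg ha, if_neg (show ¬(0 ≤ srcJ p₀ y ∧ srcJ p₀ y ≤ srcI p₀ y) by omega)]
  exact (isSHolAt_sign_mul_iff (F := slitFC p₀) hχ heq).2 (isSHolAt_slitFC_three p₀ y)

/-- **`χ F_C` at a seam corner `(v₀ + (I, 0), SE)`, `I ≥ 0`: opposite projections.** [cite: ChelkakHonglerIzyurovAnnals2015, §3.2] -/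
theorem isAntiAt_slitFCg_three (p₀ y : Site 2) (hJ : srcJ p₀ y = 0) (hI : 0 ≤ srcI p₀ y) : IsAntiAt (slitFCg p₀) (y, 3) := by
  obtain ⟨h1, h2⟩ := slitChi_three p₀ y
  have hχ : slitChi p₀ (cSrc (y, 3)) = 1 ∨ slitChi p₀ (cSrc (y, 3)) = -1 := by rw [h1]; split_ifs <;> simp
  have hop : slitChi p₀ (cTgt (y, 3)) = -slitChi p₀ (cSrc (y, 3)) := by
    rw [h1, h2, if_neg (show ¬(1 ≤ srcJ p₀ y ∧ srcJ p₀ y ≤ srcI p₀ y) by omega),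
      if_pos (show 0 ≤ srcJ p₀ y ∧ srcJ p₀ y ≤ srcI p₀ y by omega)]
  exact ((isSHolAt_sign_mul_iff_anti (F := slitFC p₀) hχ hop).2).2 (isSHolAt_slitFC_three p₀ y)

/-- **At the source corner the gauge is trivial**: `χ = 1` on both bonds of `(v₀, SW)`. [folklore] -/
theorem slitChi_source (p₀ : Site 2) :
    slitChi p₀ (cSrc (p₀ + cornerUnit 0 + cornerUnit 1, 2)) = 1 ∧ slitChi p₀ (cTgt (p₀ + cornerUnit 0 + cornerUnit 1, 2)) = 1 := by
  obtain ⟨h1, h2⟩ := slitChi_two p₀ (p₀ + cornerUnit 0 + cornerUnit 1)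
  have hI : srcI p₀ (p₀ + cornerUnit 0 + cornerUnit 1) = 0 := by simp [srcI, cornerUnit]
  have hJ : srcJ p₀ (p₀ + cornerUnit 0 + cornerUnit 1) = 0 := by simp [srcJ, cornerUnit]
  rw [h1, h2, hI, hJ]; norm_num


/-! ### The table of the difference `D = kcObs - S₀ · χ F_C` -/

section Difference

variable (G₂ : SimpleGraph (Site 2)) [G₂.LocallyFinite]

/-- **The difference** `D = F_{[Ω_δ,a]} - S₀ · F_{[ℂ_δ,a]}` in the tree's frame: the one-point spin
fermion minus the gauged explicit spinor scaled by `S₀` (for Lemma 3.5, `S₀ = ⟨σ_{v₀}⟩`). [cite: ChelkakHonglerIzyurovAnnals2015, Lemma 3.5] -/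
def kcDiff (Λ : Finset (Site 2)) (η : SpinConfig (Site 2)) (cut : Site 2 → Finset (Sym2 (Site 2))) (p₀ : Site 2) (S₀ : ℝ)
    (e : MedialVertex) : ℂ :=
  kcObs G₂ Λ η ∅ cut e - (S₀ : ℂ) * slitFCg p₀ e

variable {Λ : Finset (Site 2)} {η : SpinConfig (Site 2)} {cut : Site 2 → Finset (Sym2 (Site 2))}

/-- `kcObs`'s seam in `IsAntiAt` form at `(y, SW)`. [cite: ChelkakHonglerIzyurovAnnals2015, §3.2] -/
theorem isAntiAt_kcObs_two (hG : ∀ v ∈ Λ, ∀ k : Fin 4, G₂.Adj v (v + cornerUnit k)) (hle : G₂ ≤ zdGraph 2)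
    {B : Finset (Site 2)} {y : Site 2} (hT : cut (faceAt y 2) ⊆ edgesTouching G₂ Λ)
    (he : s(y + cornerUnit 3, y + cornerUnit 3 + cornerUnit 1) ∈ edgesTouching G₂ Λ)
    (hstep : KCGaugeEquiv G₂ Λ (symmDiff (cut (faceAt y 2)) {s(y + cornerUnit 3, y + cornerUnit 3 + cornerUnit 1)})
      (cut (faceAt y 3)))
    (hsign : hLowSign B (y + cornerUnit 2) = -vLowSign B cut (y + cornerUnit 3)) :
    IsAntiAt (kcObs G₂ Λ η B cut) (y, 2) := by
  show projLine (cornerLine y (cFace (y, 2))) (kcObs G₂ Λ η B cut (cSrc (y, 2))) =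
    -projLine (cornerLine y (cFace (y, 2))) (kcObs G₂ Λ η B cut (cTgt (y, 2)))
  simp only [cFace, cSrc, cTgt, show (2 : Fin 4) + 1 = 3 from rfl, westBond_eq, southBond_eq, kcObs_east, kcObs_north]
  exact projLine_kcObs_SW_seam G₂ hG hle hT he hstep hsign

/-- `kcObs`'s seam in `IsAntiAt` form at `(y, SE)`. [cite: ChelkakHonglerIzyurovAnnals2015, §3.2] -/
theorem isAntiAt_kcObs_three (hG : ∀ v ∈ Λ, ∀ k : Fin 4, G₂.Adj v (v + cornerUnit k)) (hle : G₂ ≤ zdGraph 2)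
    {B : Finset (Site 2)} {y : Site 2} (hT : cut (faceAt y 0) ⊆ edgesTouching G₂ Λ) (he : s(y, y + cornerUnit 0) ∈ edgesTouching G₂ Λ)
    (hstep : KCGaugeEquiv G₂ Λ (symmDiff (cut (faceAt y 0)) {s(y, y + cornerUnit 0)}) (cut (faceAt y 3)))
    (hsign : vLowSign B cut (y + cornerUnit 3) = -hLowSign B y) :
    IsAntiAt (kcObs G₂ Λ η B cut) (y, 3) := by
  show projLine (cornerLine y (cFace (y, 3))) (kcObs G₂ Λ η B cut (cSrc (y, 3))) =
    -projLine (cornerLine y (cFace (y, 3))) (kcObs G₂ Λ η B cut (cTgt (y, 3)))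
  simp only [cFace, cSrc, cTgt, show (3 : Fin 4) + 1 = 0 from rfl, southBond_eq, kcObs_east, kcObs_north]
  exact projLine_kcObs_SE_seam G₂ hG hle hT he hstep hsign

/-- **`D` at the `1`-type corners**: s-holomorphic wherever `kcObs` is. [cite: ChelkakHonglerIzyurovAnnals2015, Lemma 3.5 and Remark 3.9] -/
theorem isSHolAt_kcDiff_zero (hG : ∀ v ∈ Λ, ∀ k : Fin 4, G₂.Adj v (v + cornerUnit k)) (hle : G₂ ≤ zdGraph 2)
    (p₀ : Site 2) (S₀ : ℝ) {y : Site 2} (hT : cut (faceAt y 1) ⊆ edgesTouching G₂ Λ) (he : s(y, y + cornerUnit 1) ∈ edgesTouching G₂ Λ)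
    (hstep : KCGaugeEquiv G₂ Λ (symmDiff (cut (faceAt y 1)) {s(y, y + cornerUnit 1)}) (cut (faceAt y 0))) :
    IsSHolAt (kcDiff G₂ Λ η cut p₀ S₀) (y, 0) :=
  isSHolAt_sub_smul S₀ (isSHolAt_kcObs_zero G₂ hG hle hT he hstep) (isSHolAt_slitFCg_zero p₀ y)

/-- **`D` at the `λ̄`-type corners.** [cite: ChelkakHonglerIzyurovAnnals2015, Lemma 3.5 and Remark 3.9] -/
theorem isSHolAt_kcDiff_one (hG : ∀ v ∈ Λ, ∀ k : Fin 4, G₂.Adj v (v + cornerUnit k)) (hle : G₂ ≤ zdGraph 2)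
    (p₀ : Site 2) (S₀ : ℝ) {y : Site 2} (hT : cut (faceAt y 1) ⊆ edgesTouching G₂ Λ)
    (he : s(y + cornerUnit 2, y + cornerUnit 2 + cornerUnit 0) ∈ edgesTouching G₂ Λ)
    (hstep : KCGaugeEquiv G₂ Λ (symmDiff (cut (faceAt y 1)) {s(y + cornerUnit 2, y + cornerUnit 2 + cornerUnit 0)})
      (cut (faceAt y 2))) :
    IsSHolAt (kcDiff G₂ Λ η cut p₀ S₀) (y, 1) :=
  isSHolAt_sub_smul S₀ (isSHolAt_kcObs_one G₂ hG hle hT he hstep) (isSHolAt_slitFCg_one p₀ y)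

/-- **`D` at the `i`-type corners off the seam and off the source**: s-holomorphic. [cite: ChelkakHonglerIzyurovAnnals2015, Lemma 3.5 and Remark 3.9] -/
theorem isSHolAt_kcDiff_two (hG : ∀ v ∈ Λ, ∀ k : Fin 4, G₂.Adj v (v + cornerUnit k)) (hle : G₂ ≤ zdGraph 2)
    (p₀ : Site 2) (S₀ : ℝ) {y : Site 2} (hT : cut (faceAt y 2) ⊆ edgesTouching G₂ Λ)
    (he : s(y + cornerUnit 3, y + cornerUnit 3 + cornerUnit 1) ∈ edgesTouching G₂ Λ)
    (hstep : KCGaugeEquiv G₂ Λ (symmDiff (cut (faceAt y 2)) {s(y + cornerUnit 3, y + cornerUnit 3 + cornerUnit 1)})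
      (cut (faceAt y 3)))
    (hsign : hLowSign ∅ (y + cornerUnit 2) = vLowSign ∅ cut (y + cornerUnit 3))
    (hseam : ¬(srcJ p₀ y = 0 ∧ 1 ≤ srcI p₀ y)) (hsrc : ¬(srcI p₀ y = 0 ∧ srcJ p₀ y = 0)) :
    IsSHolAt (kcDiff G₂ Λ η cut p₀ S₀) (y, 2) :=
  isSHolAt_sub_smul S₀ (isSHolAt_kcObs_two G₂ hG hle hT he hstep hsign) (isSHolAt_slitFCg_two p₀ y hseam hsrc)

/-- **`D` on the seam, `i`-type corners**: opposite projections (the branching of a spinor). [cite: ChelkakHonglerIzyurovAnnals2015, Lemma 3.5 (on the double cover)] -/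
theorem isAntiAt_kcDiff_two (hG : ∀ v ∈ Λ, ∀ k : Fin 4, G₂.Adj v (v + cornerUnit k)) (hle : G₂ ≤ zdGraph 2)
    (p₀ : Site 2) (S₀ : ℝ) {y : Site 2} (hT : cut (faceAt y 2) ⊆ edgesTouching G₂ Λ)
    (he : s(y + cornerUnit 3, y + cornerUnit 3 + cornerUnit 1) ∈ edgesTouching G₂ Λ)
    (hstep : KCGaugeEquiv G₂ Λ (symmDiff (cut (faceAt y 2)) {s(y + cornerUnit 3, y + cornerUnit 3 + cornerUnit 1)})
      (cut (faceAt y 3)))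
    (hsign : hLowSign ∅ (y + cornerUnit 2) = -vLowSign ∅ cut (y + cornerUnit 3))
    (hJ : srcJ p₀ y = 0) (hI : 1 ≤ srcI p₀ y) :
    IsAntiAt (kcDiff G₂ Λ η cut p₀ S₀) (y, 2) :=
  anti_sub_smul S₀ (isAntiAt_kcObs_two G₂ hG hle hT he hstep hsign) (isAntiAt_slitFCg_two p₀ y hJ hI)

/-- **`D` at the `λ`-type corners off the seam.** [cite: ChelkakHonglerIzyurovAnnals2015, Lemma 3.5 and Remark 3.9] -/
theorem isSHolAt_kcDiff_three (hG : ∀ v ∈ Λ, ∀ k : Fin 4, G₂.Adj v (v + cornerUnit k)) (hle : G₂ ≤ zdGraph 2)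
    (p₀ : Site 2) (S₀ : ℝ) {y : Site 2} (hT : cut (faceAt y 0) ⊆ edgesTouching G₂ Λ) (he : s(y, y + cornerUnit 0) ∈ edgesTouching G₂ Λ)
    (hstep : KCGaugeEquiv G₂ Λ (symmDiff (cut (faceAt y 0)) {s(y, y + cornerUnit 0)}) (cut (faceAt y 3)))
    (hsign : vLowSign ∅ cut (y + cornerUnit 3) = hLowSign ∅ y) (hseam : ¬(srcJ p₀ y = 0 ∧ 0 ≤ srcI p₀ y)) :
    IsSHolAt (kcDiff G₂ Λ η cut p₀ S₀) (y, 3) :=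
  isSHolAt_sub_smul S₀ (isSHolAt_kcObs_three G₂ hG hle hT he hstep hsign) (isSHolAt_slitFCg_three p₀ y hseam)

/-- **`D` on the seam, `λ`-type corners**: opposite projections. [cite: ChelkakHonglerIzyurovAnnals2015, Lemma 3.5 (on the double cover)] -/
theorem isAntiAt_kcDiff_three (hG : ∀ v ∈ Λ, ∀ k : Fin 4, G₂.Adj v (v + cornerUnit k)) (hle : G₂ ≤ zdGraph 2)
    (p₀ : Site 2) (S₀ : ℝ) {y : Site 2} (hT : cut (faceAt y 0) ⊆ edgesTouching G₂ Λ) (he : s(y, y + cornerUnit 0) ∈ edgesTouching G₂ Λ)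
    (hstep : KCGaugeEquiv G₂ Λ (symmDiff (cut (faceAt y 0)) {s(y, y + cornerUnit 0)}) (cut (faceAt y 3)))
    (hsign : vLowSign ∅ cut (y + cornerUnit 3) = -hLowSign ∅ y) (hJ : srcJ p₀ y = 0) (hI : 0 ≤ srcI p₀ y) :
    IsAntiAt (kcDiff G₂ Λ η cut p₀ S₀) (y, 3) :=
  anti_sub_smul S₀ (isAntiAt_kcObs_three G₂ hG hle hT he hstep hsign) (isAntiAt_slitFCg_three p₀ y hJ hI)

/-- **`D` at the source corner is s-holomorphic** (Lemma 3.5 proper, with `S₀ = ⟨σ_{v₀}⟩`): the gauge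
is trivial on the two source bonds, so this is `isSHolAt_kcObs_sub_slitFC_source`. [cite: ChelkakHonglerIzyurovAnnals2015, Lemma 3.5] -/
theorem isSHolAt_kcDiff_source (hG : ∀ v ∈ Λ, ∀ k : Fin 4, G₂.Adj v (v + cornerUnit k)) (hle : G₂ ≤ zdGraph 2)
    (p₀ : Site 2) (h0 : cut p₀ = ∅)
    (he : s(p₀ + cornerUnit 0, p₀ + cornerUnit 0 + cornerUnit 1) ∈ edgesTouching G₂ Λ)
    (hstep : KCGaugeEquiv G₂ Λ (symmDiff (cut (faceAt (p₀ + cornerUnit 0) 1)) {s(p₀ + cornerUnit 0, p₀ + cornerUnit 0 + cornerUnit 1)})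
      (cut (faceAt (p₀ + cornerUnit 0) 0))) :
    IsSHolAt (kcDiff G₂ Λ η cut p₀ (kcS G₂ Λ criticalBetaTwo (.fixed η) ∅ ∅ (p₀ + cornerUnit 0 + cornerUnit 1)))
      (p₀ + cornerUnit 0 + cornerUnit 1, 2) := by
  obtain ⟨h1, h2⟩ := slitChi_source p₀
  have h := isSHolAt_kcObs_sub_slitFC_source G₂ (η := η) hG hle p₀ h0 he hstep
  refine (isSHolAt_congr ?_ ?_).2 h
  · simp only [kcDiff, slitFCg, h1]; push_cast; ring
  · simp only [kcDiff, slitFCg, h2]; push_cast; ring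

end Difference

end Literature.Probability.LatticeModels
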